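import Summits.KontsevichZagierPeriods.KontsevichZagierPeriods.Theorems.FurushoPentagonPentagonInKZCornerReps
import Summits.KontsevichZagierPeriods.KontsevichZagierPeriods.Theorems.FurushoPentagonPentagonInKZCornerBlocks

/-!
# `PentagonInKZ`, line `edge-normal-newton-leibniz`: corner engine — moving `y₀` and peeling (★B)

Shared ingredients of the Euler step `stepA_euler` and of the direct route `stepA_direct` of the
abstract corner engine (proof of `cornerEngine_uniformlyNull`, crux `FurushoPentagon.PentagonInKZ`,
stmt-KontsevichZagierPeriods-11348), stated in the engine's abstract signature (hypothesised
dictionaries and ONE hypothesis bundle `H`):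

* (M) `CornerEngineMove.moveY0_blocks` / `CornerEngineMove.moveY0_rep`: the coordinate
  permutation `ε = swap ∘ rot ∘ swap : Fin (k + (l+1) + e) ≃ Fin (k + l + e + 1)` moves the
  outermost transverse variable `y₀` of a representation on `[0,1]^{k+(l+1)+e}` to the last slot;
  the new representation (same class, rule (2)) reads the old integrand at the blocks
  `x' | y₀ :: y' | init θ'` with `y₀ = θ'_{last}`; `CornerEngineMove.snoc_blocks` computes the
  blocks of `snoc w t`.
* (★B) `CornerEngineMove.starB`: peeling the outermost transverse letter with centrality,
  `B^μ(x, y₀ :: y'; ξ, η) = Σ_b η gd_b(ξ, η y₀) B^{μ ∘ opV b}(x, y'; ξ, η y₀)` for `η, y₀ ≠ 0`, `x` in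
  the open cube and `0 < ξ ≤ α` (the commutator terms are killed by the centrality of `Z_{ℓ'}`
  against the horizontal edge transport).

References: [KontsevichZagier2001, §1.2 rule (2)]; V. G. Drinfeld, Leningrad Math. J. 2 (1991), §2;
K. Ihara, M. Kaneko, D. Zagier, Compos. Math. 142 (2006), Cor. 5.
-/

noncomputable section

open Set MeasureTheory
open Literature.NumberTheory.Transcendental
open Literature.ModelTheory.ExponentialFields (IsSemialgebraic)

namespace Summit.KontsevichZagierPeriods.FurushoPentagon.PentagonInKZ

section AbstractEngine

variable {m N : ℕ} {ℓ ℓ' : Fin (m + 2)} {α β : ℚ}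
  {Zq : Fin (m + 2) → (DrinfeldKohnoTrunc ℚ (Fin 4) N)} {wZ : ∀ {n : ℕ}, (Fin n → Fin (m + 2)) → (DrinfeldKohnoTrunc ℚ (Fin 4) N)}
  {fd gd dd : Fin (m + 2) → ℝ → ℝ → ℝ}
  {Ht Vt dHt dVt : ∀ {n : ℕ}, (Fin n → Fin (m + 2)) → (Fin n → ℝ) → ℝ → ℝ → ℝ}
  {op opV : Fin (m + 2) → (DrinfeldKohnoTrunc ℚ (Fin 4) N) →ₗ[ℚ] (DrinfeldKohnoTrunc ℚ (Fin 4) N)}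
  {Af Bf dAf dBf F : ((DrinfeldKohnoTrunc ℚ (Fin 4) N) →ₗ[ℚ] ℚ) → ∀ {k l : ℕ}, (Fin k → ℝ) → (Fin l → ℝ) → ℝ → ℝ → ℝ}
  {Xb : ∀ k l e : ℕ, (Fin (k + l + e) → ℝ) → Fin k → ℝ}
  {Yb : ∀ k l e : ℕ, (Fin (k + l + e) → ℝ) → Fin l → ℝ}
  {Θb : ∀ k l e : ℕ, (Fin (k + l + e) → ℝ) → Fin e → ℝ}

variable (H :
    (∀ {n : ℕ} (U : Fin n → Fin (m + 2)), wZ U = ((List.ofFn U).map Zq).prod) ∧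
    (∀ (a : Fin (m + 2)) (X : (DrinfeldKohnoTrunc ℚ (Fin 4) N)), op a X = if a = ℓ then Zq ℓ * X - X * Zq ℓ else Zq a * X) ∧
    (∀ (b : Fin (m + 2)) (X : (DrinfeldKohnoTrunc ℚ (Fin 4) N)), opV b X = if b = ℓ' then Zq ℓ' * X - X * Zq ℓ' else Zq b * X) ∧
    (∀ (μ : (DrinfeldKohnoTrunc ℚ (Fin 4) N) →ₗ[ℚ] ℚ) {k l : ℕ} (x : Fin k → ℝ) (y : Fin l → ℝ) (ξ η : ℝ), Af μ x y ξ η = ∑ U : Fin k → Fin (m + 2), ∑ V : Fin l → Fin (m + 2), (μ (wZ U * wZ V) : ℝ) * (Ht U x ξ η * Vt V y 0 η)) ∧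
    (∀ (μ : (DrinfeldKohnoTrunc ℚ (Fin 4) N) →ₗ[ℚ] ℚ) {k l : ℕ} (x : Fin k → ℝ) (y : Fin l → ℝ) (ξ η : ℝ), Bf μ x y ξ η = ∑ U : Fin k → Fin (m + 2), ∑ V : Fin l → Fin (m + 2), (μ (wZ V * wZ U) : ℝ) * (Vt V y ξ η * Ht U x ξ 0)) ∧
    (∀ (μ : (DrinfeldKohnoTrunc ℚ (Fin 4) N) →ₗ[ℚ] ℚ) {k l : ℕ} (x : Fin k → ℝ) (y : Fin l → ℝ) (ξ η : ℝ), dAf μ x y ξ η = ∑ U : Fin k → Fin (m + 2), ∑ V : Fin l → Fin (m + 2), (μ (wZ U * wZ V) : ℝ) * (dHt U x ξ η * Vt V y 0 η)) ∧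
    (∀ (μ : (DrinfeldKohnoTrunc ℚ (Fin 4) N) →ₗ[ℚ] ℚ) {k l : ℕ} (x : Fin k → ℝ) (y : Fin l → ℝ) (ξ η : ℝ), dBf μ x y ξ η = ∑ U : Fin k → Fin (m + 2), ∑ V : Fin l → Fin (m + 2), (μ (wZ V * wZ U) : ℝ) * (dVt V y ξ η * Ht U x ξ 0)) ∧
    (∀ (μ : (DrinfeldKohnoTrunc ℚ (Fin 4) N) →ₗ[ℚ] ℚ) {k l : ℕ} (x : Fin k → ℝ) (y : Fin l → ℝ) (ξ η : ℝ), F μ x y ξ η = Af μ x y ξ η - Bf μ x y ξ η) ∧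
    (∀ (k l e : ℕ) (z : Fin (k + l + e) → ℝ), Xb k l e z = fun i => z (Fin.castAdd e (Fin.castAdd l i))) ∧
    (∀ (k l e : ℕ) (z : Fin (k + l + e) → ℝ), Yb k l e z = fun j => z (Fin.castAdd e (Fin.natAdd k j))) ∧
    (∀ (k l e : ℕ) (z : Fin (k + l + e) → ℝ), Θb k l e z = fun s => z (Fin.natAdd (k + l) s)) ∧
    (∀ (U : Fin 0 → Fin (m + 2)) (x : Fin 0 → ℝ) (ξ η : ℝ), Ht U x ξ η = 1) ∧
    (∀ (V : Fin 0 → Fin (m + 2)) (y : Fin 0 → ℝ) (ξ η : ℝ), Vt V y ξ η = 1) ∧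
    (∀ (U : Fin 0 → Fin (m + 2)) (x : Fin 0 → ℝ) (ξ η : ℝ), dHt U x ξ η = 0) ∧
    (∀ (V : Fin 0 → Fin (m + 2)) (y : Fin 0 → ℝ) (ξ η : ℝ), dVt V y ξ η = 0) ∧
    (∀ {k : ℕ} (U : Fin (k + 1) → Fin (m + 2)) (x : Fin (k + 1) → ℝ) (η : ℝ), Ht U x 0 η = 0) ∧
    (∀ {l : ℕ} (V : Fin (l + 1) → Fin (m + 2)) (y : Fin (l + 1) → ℝ) (ξ : ℝ), Vt V y ξ 0 = 0) ∧
    (∀ t y : ℝ, fd ℓ t y = 1 / t) ∧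
    (∀ x s : ℝ, gd ℓ' x s = 1 / s) ∧
    (∀ x y : ℝ, dd ℓ x y = 0) ∧
    (∀ x y : ℝ, dd ℓ' x y = 0) ∧
    (∀ (μ : (DrinfeldKohnoTrunc ℚ (Fin 4) N) →ₗ[ℚ] ℚ) {k : ℕ} (x₀ : ℝ) (x' : Fin k → ℝ) (ξ η : ℝ), ∑ U : Fin (k + 1) → Fin (m + 2), (μ (wZ U) : ℝ) * Ht U (Fin.cons x₀ x') ξ η = (∑ a : Fin (m + 2), (if a = ℓ then 1 / x₀ else ξ * fd a (ξ * x₀) η) * ∑ U' : Fin k → Fin (m + 2), (μ (Zq a * wZ U') : ℝ) * Ht U' x' (ξ * x₀) η) - (1 / x₀) * ∑ U' : Fin k → Fin (m + 2), (μ (wZ U' * Zq ℓ) : ℝ) * Ht U' x' (ξ * x₀) η) ∧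
    (∀ (μ : (DrinfeldKohnoTrunc ℚ (Fin 4) N) →ₗ[ℚ] ℚ) {l : ℕ} (y₀ : ℝ) (y' : Fin l → ℝ) (ξ η : ℝ), ∑ V : Fin (l + 1) → Fin (m + 2), (μ (wZ V) : ℝ) * Vt V (Fin.cons y₀ y') ξ η = (∑ b : Fin (m + 2), (if b = ℓ' then 1 / y₀ else η * gd b ξ (η * y₀)) * ∑ V' : Fin l → Fin (m + 2), (μ (Zq b * wZ V') : ℝ) * Vt V' y' ξ (η * y₀)) - (1 / y₀) * ∑ V' : Fin l → Fin (m + 2), (μ (wZ V' * Zq ℓ') : ℝ) * Vt V' y' ξ (η * y₀)) ∧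
    (∀ (μ : (DrinfeldKohnoTrunc ℚ (Fin 4) N) →ₗ[ℚ] ℚ) {l : ℕ} (P Q : (DrinfeldKohnoTrunc ℚ (Fin 4) N)) (y : Fin l → ℝ) (η : ℝ), (∀ i, 0 < y i ∧ y i < 1) → 0 < η → η ≤ (β : ℝ) → ∑ V : Fin l → Fin (m + 2), (μ (P * (Zq ℓ * wZ V - wZ V * Zq ℓ) * Q) : ℝ) * Vt V y 0 η = 0) ∧
    (∀ (μ : (DrinfeldKohnoTrunc ℚ (Fin 4) N) →ₗ[ℚ] ℚ) {k : ℕ} (P Q : (DrinfeldKohnoTrunc ℚ (Fin 4) N)) (x : Fin k → ℝ) (ξ : ℝ), (∀ i, 0 < x i ∧ x i < 1) → 0 < ξ → ξ ≤ (α : ℝ) → ∑ U : Fin k → Fin (m + 2), (μ (P * (Zq ℓ' * wZ U - wZ U * Zq ℓ') * Q) : ℝ) * Ht U x ξ 0 = 0) ∧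
    (∀ (μ : (DrinfeldKohnoTrunc ℚ (Fin 4) N) →ₗ[ℚ] ℚ) (P Q : (DrinfeldKohnoTrunc ℚ (Fin 4) N)), μ (P * (Zq ℓ * Zq ℓ' - Zq ℓ' * Zq ℓ) * Q) = 0) ∧
    (∀ (μ : (DrinfeldKohnoTrunc ℚ (Fin 4) N) →ₗ[ℚ] ℚ) (P Q : (DrinfeldKohnoTrunc ℚ (Fin 4) N)) (x y : ℝ), 0 < x → x < (α : ℝ) → 0 < y → y < (β : ℝ) → ∑ a : Fin (m + 2), ∑ b : Fin (m + 2), (fd a x y * gd b x y) * (μ (P * (Zq a * Zq b - Zq b * Zq a) * Q) : ℝ) = 0) ∧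
    (∀ (μ : (DrinfeldKohnoTrunc ℚ (Fin 4) N) →ₗ[ℚ] ℚ) (P Q : (DrinfeldKohnoTrunc ℚ (Fin 4) N)) (s : ℝ), 0 < s → s < (β : ℝ) → ∑ b : Fin (m + 2), gd b 0 s * (μ (P * (Zq ℓ * Zq b - Zq b * Zq ℓ) * Q) : ℝ) = 0) ∧
    (∀ (μ : (DrinfeldKohnoTrunc ℚ (Fin 4) N) →ₗ[ℚ] ℚ) (P Q : (DrinfeldKohnoTrunc ℚ (Fin 4) N)) (t : ℝ), 0 < t → t < (α : ℝ) → ∑ a : Fin (m + 2), fd a t 0 * (μ (P * (Zq ℓ' * Zq a - Zq a * Zq ℓ') * Q) : ℝ) = 0) ∧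
    (∀ (a : Fin (m + 2)) (ξ η : ℝ), 0 ≤ ξ → ξ ≤ (α : ℝ) → 0 ≤ η → η ≤ (β : ℝ) → HasDerivAt (fun y => fd a ξ y) (dd a ξ η) η) ∧
    (∀ (b : Fin (m + 2)) (ξ η : ℝ), 0 ≤ ξ → ξ ≤ (α : ℝ) → 0 ≤ η → η ≤ (β : ℝ) → HasDerivAt (fun x => gd b x η) (dd b ξ η) ξ) ∧
    (∀ {k : ℕ} (U : Fin k → Fin (m + 2)) (x : Fin k → ℝ) (ξ η : ℝ), (∀ i, 0 ≤ x i ∧ x i ≤ 1) → 0 ≤ ξ → ξ ≤ (α : ℝ) → 0 ≤ η → η ≤ (β : ℝ) → HasDerivAt (fun t => Ht U x t η) (dHt U x ξ η) ξ) ∧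
    (∀ {l : ℕ} (V : Fin l → Fin (m + 2)) (y : Fin l → ℝ) (ξ η : ℝ), (∀ i, 0 ≤ y i ∧ y i ≤ 1) → 0 ≤ ξ → ξ ≤ (α : ℝ) → 0 ≤ η → η ≤ (β : ℝ) → HasDerivAt (fun s => Vt V y ξ s) (dVt V y ξ η) η) ∧
    (∀ {k : ℕ} (U : Fin (k + 1) → Fin (m + 2)) (x₀ : ℝ) (x' : Fin k → ℝ) (ξ η : ℝ), 0 < x₀ → x₀ < 1 → (∀ i, 0 ≤ x' i ∧ x' i ≤ 1) → 0 ≤ ξ → ξ ≤ (α : ℝ) → 0 ≤ η → η ≤ (β : ℝ) → HasDerivAt (fun t => t * Ht U (Fin.cons t x') ξ η) (ξ * dHt U (Fin.cons x₀ x') ξ η) x₀) ∧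
    (∀ {l : ℕ} (V : Fin (l + 1) → Fin (m + 2)) (y₀ : ℝ) (y' : Fin l → ℝ) (ξ η : ℝ), 0 < y₀ → y₀ < 1 → (∀ i, 0 ≤ y' i ∧ y' i ≤ 1) → 0 ≤ ξ → ξ ≤ (α : ℝ) → 0 ≤ η → η ≤ (β : ℝ) → HasDerivAt (fun t => t * Vt V (Fin.cons t y') ξ η) (η * dVt V (Fin.cons y₀ y') ξ η) y₀) ∧
    (∀ {k : ℕ} (U : Fin (k + 1) → Fin (m + 2)) (x' : Fin k → ℝ) (ξ η : ℝ), (∀ i, 0 ≤ x' i ∧ x' i ≤ 1) → 0 ≤ ξ → ξ ≤ (α : ℝ) → 0 ≤ η → η ≤ (β : ℝ) → ContinuousOn (fun t => t * Ht U (Fin.cons t x') ξ η) (Set.Icc 0 1)) ∧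
    (∀ {l : ℕ} (V : Fin (l + 1) → Fin (m + 2)) (y' : Fin l → ℝ) (ξ η : ℝ), (∀ i, 0 ≤ y' i ∧ y' i ≤ 1) → 0 ≤ ξ → ξ ≤ (α : ℝ) → 0 ≤ η → η ≤ (β : ℝ) → ContinuousOn (fun t => t * Vt V (Fin.cons t y') ξ η) (Set.Icc 0 1)) ∧
    (∀ {d : ℕ} {W : Set (Fin d → ℝ)}, IsSemialgebraic ℚ W → ∀ (a : Fin (m + 2)) {T Y : (Fin d → ℝ) → ℝ}, IsSemialgebraicFunOn ℚ W T → IsSemialgebraicFunOn ℚ W Y → IsSemialgebraicFunOn ℚ W fun z => fd a (T z) (Y z)) ∧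
    (∀ {d : ℕ} {W : Set (Fin d → ℝ)}, IsSemialgebraic ℚ W → ∀ (b : Fin (m + 2)) {T Y : (Fin d → ℝ) → ℝ}, IsSemialgebraicFunOn ℚ W T → IsSemialgebraicFunOn ℚ W Y → IsSemialgebraicFunOn ℚ W fun z => gd b (T z) (Y z)) ∧
    (∀ {d : ℕ} {W : Set (Fin d → ℝ)}, IsSemialgebraic ℚ W → ∀ (a : Fin (m + 2)) {T Y : (Fin d → ℝ) → ℝ}, IsSemialgebraicFunOn ℚ W T → IsSemialgebraicFunOn ℚ W Y → IsSemialgebraicFunOn ℚ W fun z => dd a (T z) (Y z)) ∧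
    (∀ {d : ℕ} {W : Set (Fin d → ℝ)}, IsSemialgebraic ℚ W → ∀ {n : ℕ} (U : Fin n → Fin (m + 2)) {X : (Fin d → ℝ) → Fin n → ℝ} {P Q : (Fin d → ℝ) → ℝ}, (∀ i, IsSemialgebraicFunOn ℚ W fun z => X z i) → IsSemialgebraicFunOn ℚ W P → IsSemialgebraicFunOn ℚ W Q → IsSemialgebraicFunOn ℚ W fun z => Ht U (X z) (P z) (Q z)) ∧
    (∀ {d : ℕ} {W : Set (Fin d → ℝ)}, IsSemialgebraic ℚ W → ∀ {n : ℕ} (V : Fin n → Fin (m + 2)) {Y : (Fin d → ℝ) → Fin n → ℝ} {P Q : (Fin d → ℝ) → ℝ}, (∀ i, IsSemialgebraicFunOn ℚ W fun z => Y z i) → IsSemialgebraicFunOn ℚ W P → IsSemialgebraicFunOn ℚ W Q → IsSemialgebraicFunOn ℚ W fun z => Vt V (Y z) (P z) (Q z)) ∧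
    (∀ {d : ℕ} {W : Set (Fin d → ℝ)}, IsSemialgebraic ℚ W → ∀ {n : ℕ} (U : Fin n → Fin (m + 2)) {X : (Fin d → ℝ) → Fin n → ℝ} {P Q : (Fin d → ℝ) → ℝ}, (∀ i, IsSemialgebraicFunOn ℚ W fun z => X z i) → IsSemialgebraicFunOn ℚ W P → IsSemialgebraicFunOn ℚ W Q → IsSemialgebraicFunOn ℚ W fun z => dHt U (X z) (P z) (Q z)) ∧
    (∀ {d : ℕ} {W : Set (Fin d → ℝ)}, IsSemialgebraic ℚ W → ∀ {n : ℕ} (V : Fin n → Fin (m + 2)) {Y : (Fin d → ℝ) → Fin n → ℝ} {P Q : (Fin d → ℝ) → ℝ}, (∀ i, IsSemialgebraicFunOn ℚ W fun z => Y z i) → IsSemialgebraicFunOn ℚ W P → IsSemialgebraicFunOn ℚ W Q → IsSemialgebraicFunOn ℚ W fun z => dVt V (Y z) (P z) (Q z)) ∧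
    (∃ C : ℝ, ∀ (a : Fin (m + 2)) (ξ η : ℝ), 0 ≤ ξ → ξ ≤ (α : ℝ) → 0 ≤ η → η ≤ (β : ℝ) → (a ≠ ℓ → |fd a ξ η| ≤ C) ∧ (a ≠ ℓ' → |gd a ξ η| ≤ C) ∧ |dd a ξ η| ≤ C ∧ (∀ η' : ℝ, 0 ≤ η' → η' ≤ (β : ℝ) → |fd a ξ η - fd a ξ η'| ≤ C * |η - η'|) ∧ (∀ ξ' : ℝ, 0 ≤ ξ' → ξ' ≤ (α : ℝ) → |gd a ξ η - gd a ξ' η| ≤ C * |ξ - ξ'|)) ∧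
    (∀ k : ℕ, ∃ C : ℝ, ∀ (U : Fin k → Fin (m + 2)) (x : Fin k → ℝ) (ξ η : ℝ), (∀ i, 0 ≤ x i ∧ x i ≤ 1) → 0 ≤ ξ → ξ ≤ (α : ℝ) → 0 ≤ η → η ≤ (β : ℝ) → |Ht U x ξ η| ≤ C ∧ |dHt U x ξ η| ≤ C ∧ (0 < k → |Ht U x ξ η| ≤ C * ξ) ∧ (∀ η' : ℝ, 0 ≤ η' → η' ≤ (β : ℝ) → |Ht U x ξ η - Ht U x ξ η'| ≤ C * ξ * |η - η'|)) ∧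
    (∀ l : ℕ, ∃ C : ℝ, ∀ (V : Fin l → Fin (m + 2)) (y : Fin l → ℝ) (ξ η : ℝ), (∀ i, 0 ≤ y i ∧ y i ≤ 1) → 0 ≤ ξ → ξ ≤ (α : ℝ) → 0 ≤ η → η ≤ (β : ℝ) → |Vt V y ξ η| ≤ C ∧ |dVt V y ξ η| ≤ C ∧ (0 < l → |Vt V y ξ η| ≤ C * η) ∧ (∀ ξ' : ℝ, 0 ≤ ξ' → ξ' ≤ (α : ℝ) → |Vt V y ξ η - Vt V y ξ' η| ≤ C * η * |ξ - ξ'|)))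

/-! ### (M) Moving the outermost transverse variable `y₀` to the last slot -/

namespace CornerEngineMove

/-- **Moving `y₀` to the last slot** (pure coordinate bookkeeping): for the permutation
`ε = swap ∘ rot ∘ swap : Fin (k + (l+1) + e) ≃ Fin (k + l + e + 1)` (exchange the two variable
blocks, move the outermost variable to the last slot, exchange back), the blocks of `z = w ∘ ε` in
layout `(k, l+1, e)` are `x = x'`, `y = y₀ :: y'`, `θ = init θ'`, where `w` has blocks
`x' | y' | θ'` in layout `(k, l, e+1)` and `y₀ = θ'_{last}`. [folklore] -/
theorem moveY0_blocks {k l e : ℕ} (h : l + 1 + k + e = l + k + e + 1) (w : Fin (k + l + (e + 1)) → ℝ) :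
    let ε : Fin (k + (l + 1) + e) ≃ Fin (k + l + e + 1) :=
      (finSumFinEquiv.symm.trans ((Equiv.sumCongr (finSumFinEquiv.symm.trans
        ((Equiv.sumComm (Fin k) (Fin (l + 1))).trans finSumFinEquiv)) (Equiv.refl (Fin e))).trans
          finSumFinEquiv)).trans
      (((finCongr h).trans (finRotate (l + k + e + 1)).symm).trans
        (finSumFinEquiv.symm.trans ((Equiv.sumCongr (finSumFinEquiv.symm.trans
          ((Equiv.sumComm (Fin l) (Fin k)).trans finSumFinEquiv)) (Equiv.refl (Fin (e + 1)))).trans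
            finSumFinEquiv) : Fin (l + k + (e + 1)) ≃ Fin (k + l + (e + 1))))
    (fun i : Fin k => w (ε (Fin.castAdd e (Fin.castAdd (l + 1) i)))) =
        (fun i : Fin k => w (Fin.castAdd (e + 1) (Fin.castAdd l i))) ∧
      (fun j : Fin (l + 1) => w (ε (Fin.castAdd e (Fin.natAdd k j)))) =
        Fin.cons (w (Fin.natAdd (k + l) (Fin.last e))) (fun j : Fin l => w (Fin.castAdd (e + 1) (Fin.natAdd k j))) ∧
      (fun s : Fin e => w (ε (Fin.natAdd (k + (l + 1)) s))) =
        (fun s : Fin e => w (Fin.natAdd (k + l) (Fin.castSucc s))) := by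
  intro ε
  -- the three constituents, read on the appropriate pull-backs of `w`
  set ε₃ : Fin (l + k + (e + 1)) ≃ Fin (k + l + (e + 1)) :=
    finSumFinEquiv.symm.trans ((Equiv.sumCongr (finSumFinEquiv.symm.trans
      ((Equiv.sumComm (Fin l) (Fin k)).trans finSumFinEquiv)) (Equiv.refl (Fin (e + 1)))).trans
        finSumFinEquiv) with hε₃
  obtain ⟨h1, h2, h3⟩ := CornerBlocks.swapBlocks_blocks (k := k) (l := l + 1) (e := e)
    (fun j => w (ε₃ ((finRotate (l + k + e + 1)).symm (Fin.cast h j))))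
  obtain ⟨r1, r2, r3⟩ := CornerBlocks.rot_blocks (k := l) (l := k) (e := e) h (fun j => w (ε₃ j))
  obtain ⟨s1, s2, s3⟩ := CornerBlocks.swapBlocks_blocks (k := l) (l := k) (e := e + 1) w
  refine ⟨?_, ?_, ?_⟩
  · exact h1.trans (r2.trans s2)
  · refine h2.trans (r1.trans ?_)
    rw [s1]
    congr 1
    exact congrFun s3 (Fin.last e)
  · refine h3.trans (r3.trans ?_)
    funext s
    exact congrFun s3 (Fin.castSucc s)

end CornerEngineMove

include H in
/-- The blocks of `snoc w t` in layout `(k, l, e+1)`: the variable blocks of `w` and the parameter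
block `snoc θ t`. [folklore] -/
theorem CornerEngineMove.snoc_blocks {k l e : ℕ} (w : Fin (k + l + e) → ℝ) (t : ℝ) :
    Xb k l (e + 1) (Fin.snoc w t : Fin (k + l + e + 1) → ℝ) = Xb k l e w ∧
      Yb k l (e + 1) (Fin.snoc w t : Fin (k + l + e + 1) → ℝ) = Yb k l e w ∧
      Θb k l (e + 1) (Fin.snoc w t : Fin (k + l + e + 1) → ℝ) = Fin.snoc (Θb k l e w) t ∧
      Θb k l (e + 1) (Fin.snoc w t : Fin (k + l + e + 1) → ℝ) (Fin.last e) = t ∧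
      Fin.init (Θb k l (e + 1) (Fin.snoc w t : Fin (k + l + e + 1) → ℝ)) = Θb k l e w := by
  obtain ⟨_, _, _, _, _, _, _, _, hXb, hYb, hΘb, -⟩ := H
  have hΘ : Θb k l (e + 1) (Fin.snoc w t : Fin (k + l + e + 1) → ℝ) = Fin.snoc (Θb k l e w) t := by
    rw [hΘb, hΘb]
    funext s
    refine Fin.lastCases ?_ (fun s' => ?_) s
    · have : (Fin.natAdd (k + l) (Fin.last e) : Fin (k + l + e + 1)) = Fin.last (k + l + e) :=
        Fin.ext rfl
      rw [this, Fin.snoc_last, Fin.snoc_last]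
    · have : (Fin.natAdd (k + l) (Fin.castSucc s') : Fin (k + l + e + 1)) =
          Fin.castSucc (Fin.natAdd (k + l) s') := Fin.ext rfl
      rw [this, Fin.snoc_castSucc, Fin.snoc_castSucc]
  refine ⟨?_, ?_, hΘ, ?_, ?_⟩
  · rw [hXb, hXb]
    funext i
    have : (Fin.castAdd (e + 1) (Fin.castAdd l i) : Fin (k + l + e + 1)) =
        Fin.castSucc (Fin.castAdd e (Fin.castAdd l i)) := Fin.ext rfl
    rw [this, Fin.snoc_castSucc]
  · rw [hYb, hYb]
    funext j
    have : (Fin.castAdd (e + 1) (Fin.natAdd k j) : Fin (k + l + e + 1)) =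
        Fin.castSucc (Fin.castAdd e (Fin.natAdd k j)) := Fin.ext rfl
    rw [this, Fin.snoc_castSucc]
  · rw [hΘ, Fin.snoc_last]
  · rw [hΘ, Fin.init_snoc]

include H in
/-- **Moving `y₀` to the last slot, for representations** (rule (2) along the permutation of
`CornerEngineMove.moveY0_blocks`): a representation on `[0,1]^{k+(l+1)+e}` whose integrand reads
the blocks `x | y | θ` has the same class as a representation on `[0,1]^{k+l+e+1}` reading
`x' | y₀ :: y' | init θ'` with `y₀ = θ'_{last}`. [cite: KontsevichZagier2001, §1.2 rule (2)] -/
theorem CornerEngineMove.moveY0_rep {k l e : ℕ} (g : (Fin k → ℝ) → (Fin (l + 1) → ℝ) → (Fin e → ℝ) → ℝ)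
    (r : KZ.IntegralRep (k + (l + 1) + e)) (hrd : r.domain = KZ.cube (k + (l + 1) + e))
    (hri : r.integrand = fun z => g (Xb k (l + 1) e z) (Yb k (l + 1) e z) (Θb k (l + 1) e z)) :
    ∃ r' : KZ.IntegralRep (k + l + e + 1), r'.domain = KZ.cube (k + l + e + 1) ∧
      (r'.integrand = fun w => g (Xb k l (e + 1) w)
        (Fin.cons (Θb k l (e + 1) w (Fin.last e)) (Yb k l (e + 1) w)) (Fin.init (Θb k l (e + 1) w))) ∧
      KZ.toPeriodAlgebra (KZ.toFormalPeriod (KZ.of r')) = KZ.toPeriodAlgebra (KZ.toFormalPeriod (KZ.of r)) := by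
  have h : l + 1 + k + e = l + k + e + 1 := by omega
  obtain ⟨_, _, _, _, _, _, _, _, hXb, hYb, hΘb, -⟩ := H
  refine ⟨r.reindex ((finSumFinEquiv.symm.trans ((Equiv.sumCongr (finSumFinEquiv.symm.trans
        ((Equiv.sumComm (Fin k) (Fin (l + 1))).trans finSumFinEquiv)) (Equiv.refl (Fin e))).trans
          finSumFinEquiv)).trans
      (((finCongr h).trans (finRotate (l + k + e + 1)).symm).trans
        (finSumFinEquiv.symm.trans ((Equiv.sumCongr (finSumFinEquiv.symm.trans
          ((Equiv.sumComm (Fin l) (Fin k)).trans finSumFinEquiv)) (Equiv.refl (Fin (e + 1)))).trans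
            finSumFinEquiv) : Fin (l + k + (e + 1)) ≃ Fin (k + l + (e + 1))))),
    CornerReps.reindex_domain_cube r _ hrd, ?_, CornerReps.cls_reindex r _⟩
  funext w
  obtain ⟨h1, h2, h3⟩ := CornerEngineMove.moveY0_blocks (k := k) (l := l) (e := e) h w
  rw [CornerReps.reindex_integrand, hri]
  simp only [hXb, hYb, hΘb]
  rw [h1, h2, h3]
  rfl

/-! ### (★B) Peeling the outermost transverse letter, with centrality -/

namespace CornerEngineMove

include H in
/-- Moving the transverse insertion operator across a right factor:
`ν(opV_b(X) Y) = ν(opV_b(X Y)) − [b = ℓ'] ν(X [Z_{ℓ'}, Y])`. [folklore] -/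
theorem opV_mul_right (ν : (DrinfeldKohnoTrunc ℚ (Fin 4) N) →ₗ[ℚ] ℚ) (b : Fin (m + 2))
    (X Y : DrinfeldKohnoTrunc ℚ (Fin 4) N) :
    (ν (opV b X * Y) : ℝ) = (ν (opV b (X * Y)) : ℝ) -
      (if b = ℓ' then (ν (X * (Zq ℓ' * Y - Y * Zq ℓ') * 1) : ℝ) else 0) := by
  obtain ⟨_, _, hopV, -⟩ := H
  by_cases hb : b = ℓ'
  · subst hb
    rw [if_pos rfl, hopV, hopV, if_pos rfl, if_pos rfl, ← Rat.cast_sub, ← map_sub]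
    congr 2; noncomm_ring
  · rw [if_neg hb, hopV, hopV, if_neg hb, if_neg hb, sub_zero, mul_assoc]

include H in
/-- **Resummation of the peeled transverse coefficient**: with `c_{ℓ'} = 1/s`, the right-hand side
of the transverse peeling identity is `Σ_b c_b Σ_{V'} ν(opV_b(wZ V')) g(V')`. [folklore] -/
theorem peelV_resum (ν : (DrinfeldKohnoTrunc ℚ (Fin 4) N) →ₗ[ℚ] ℚ) {l : ℕ} (g : (Fin l → Fin (m + 2)) → ℝ)
    (c : Fin (m + 2) → ℝ) (s : ℝ) (hc : c ℓ' = 1 / s) :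
    ∑ b : Fin (m + 2), c b * ∑ V' : Fin l → Fin (m + 2), (ν (opV b (wZ V')) : ℝ) * g V' =
      (∑ b : Fin (m + 2), c b * ∑ V' : Fin l → Fin (m + 2), (ν (Zq b * wZ V') : ℝ) * g V') -
        (1 / s) * ∑ V' : Fin l → Fin (m + 2), (ν (wZ V' * Zq ℓ') : ℝ) * g V' := by
  obtain ⟨_, _, hopV, -⟩ := H
  have key : ∀ b : Fin (m + 2), c b * ∑ V' : Fin l → Fin (m + 2), (ν (opV b (wZ V')) : ℝ) * g V' =
      c b * ∑ V' : Fin l → Fin (m + 2), (ν (Zq b * wZ V') : ℝ) * g V' -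
        (if b = ℓ' then (1 / s) * ∑ V' : Fin l → Fin (m + 2), (ν (wZ V' * Zq ℓ') : ℝ) * g V' else 0) := by
    intro b
    by_cases hb : b = ℓ'
    · subst hb
      rw [if_pos rfl, ← hc, ← mul_sub, ← Finset.sum_sub_distrib]
      congr 1
      refine Finset.sum_congr rfl fun V' _ => ?_
      rw [hopV, if_pos rfl, map_sub, Rat.cast_sub, sub_mul]
    · rw [if_neg hb, sub_zero]
      congr 1
      refine Finset.sum_congr rfl fun V' _ => ?_
      rw [hopV, if_neg hb]
  rw [Finset.sum_congr rfl fun b _ => key b, Finset.sum_sub_distrib, Finset.sum_ite_eq']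
  simp only [Finset.mem_univ, if_true]

include H in
/-- **Peeling the outermost transverse letter, insertion-operator form** (pure algebra;
`η, y₀ ≠ 0`): `Σ_V μ(wZ V · wZ U) Vt V (y₀ :: y') ξ η
  = Σ_b η gd_b(ξ, η y₀) Σ_{V'} μ(opV_b(wZ V') · wZ U) Vt V' y' ξ (η y₀)`.
[cite: IharaKanekoZagier2006, Cor. 5] -/
theorem peelV_op (μ : (DrinfeldKohnoTrunc ℚ (Fin 4) N) →ₗ[ℚ] ℚ) {l : ℕ} (y₀ : ℝ) (y' : Fin l → ℝ) (ξ η : ℝ)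
    (hη : η ≠ 0) (hy₀ : y₀ ≠ 0) {k : ℕ} (U : Fin k → Fin (m + 2)) :
    ∑ V : Fin (l + 1) → Fin (m + 2), (μ (wZ V * wZ U) : ℝ) * Vt V (Fin.cons y₀ y') ξ η =
      ∑ b : Fin (m + 2), (η * gd b ξ (η * y₀)) *
        ∑ V' : Fin l → Fin (m + 2), (μ (opV b (wZ V') * wZ U) : ℝ) * Vt V' y' ξ (η * y₀) := by
  have H' := H
  obtain ⟨_, _, _, _, _, _, _, _, _, _, _, _, _, _, _, _, _, _, hgd_reg, _, _, _, hpeelV, -⟩ := H'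
  -- the functional `X ↦ μ (X * wZ U)`
  have h := hpeelV (μ ∘ₗ LinearMap.mulRight ℚ (wZ U)) y₀ y' ξ η
  simp only [LinearMap.comp_apply, LinearMap.mulRight_apply] at h
  rw [h]
  have hcoef : ∀ b : Fin (m + 2), (if b = ℓ' then 1 / y₀ else η * gd b ξ (η * y₀)) = η * gd b ξ (η * y₀) := by
    intro b
    split_ifs with hb
    · subst hb; rw [hgd_reg]; field_simp
    · rfl
  simp only [hcoef]
  have h2 := peelV_resum H (μ ∘ₗ LinearMap.mulRight ℚ (wZ U)) (fun V' => Vt V' y' ξ (η * y₀))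
    (fun b => η * gd b ξ (η * y₀)) y₀ (by rw [hgd_reg]; field_simp)
  simp only [LinearMap.comp_apply, LinearMap.mulRight_apply] at h2
  rw [h2]

end CornerEngineMove

include H in
/-- **(★B) Peeling with centrality**: for `η ≠ 0`, `y₀ ≠ 0`, `x` in the open cube and
`0 < ξ ≤ α`, `Bf μ x (y₀ :: y') ξ η = Σ_b η gd_b(ξ, η y₀) Bf (μ ∘ opV_b) x y' ξ (η y₀)`
(the commutator terms `μ(wZ V' [Z_{ℓ'}, wZ U])` are killed by the centrality of `Z_{ℓ'}` against
the horizontal edge transport). [cite: Drinfeld1991, §2] -/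
theorem CornerEngineMove.starB (μ : (DrinfeldKohnoTrunc ℚ (Fin 4) N) →ₗ[ℚ] ℚ) {k l : ℕ} (y₀ : ℝ) (y' : Fin l → ℝ)
    (x : Fin k → ℝ) (ξ η : ℝ) (hη : η ≠ 0) (hy₀ : y₀ ≠ 0) (hx : ∀ i, 0 < x i ∧ x i < 1) (hξ : 0 < ξ)
    (hξα : ξ ≤ (α : ℝ)) :
    Bf μ x (Fin.cons y₀ y') ξ η =
      ∑ b : Fin (m + 2), (η * gd b ξ (η * y₀)) * Bf (μ ∘ₗ opV b) x y' ξ (η * y₀) := by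
  have H' := H
  obtain ⟨_, _, _, _, hBf, _, _, _, _, _, _, _, _, _, _, _, _, _, _, _, _, _, _, _, hcentH, -⟩ := H'
  -- peel the outermost transverse letter, for every horizontal word `U`
  have hpeel : ∀ U : Fin k → Fin (m + 2),
      ∑ V : Fin (l + 1) → Fin (m + 2), (μ (wZ V * wZ U) : ℝ) * (Vt V (Fin.cons y₀ y') ξ η * Ht U x ξ 0) =
        ∑ b : Fin (m + 2), ∑ V' : Fin l → Fin (m + 2), (η * gd b ξ (η * y₀)) *
          ((μ (opV b (wZ V') * wZ U) : ℝ) * (Vt V' y' ξ (η * y₀) * Ht U x ξ 0)) := by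
    intro U
    have h := congrArg (· * Ht U x ξ 0) (CornerEngineMove.peelV_op H μ y₀ y' ξ η hη hy₀ U)
    simp only [Finset.sum_mul] at h
    refine (Finset.sum_congr rfl fun V _ => by ring).trans (h.trans ?_)
    refine Finset.sum_congr rfl fun b _ => ?_
    rw [Finset.mul_sum, Finset.sum_mul]
    exact Finset.sum_congr rfl fun V' _ => by ring
  rw [hBf, Finset.sum_congr rfl fun U _ => hpeel U, Finset.sum_comm]
  refine Finset.sum_congr rfl fun b _ => ?_
  -- move `opV b` across `wZ U` and use the centrality of `Z_{ℓ'}` (sum over `U` innermost)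
  rw [Finset.sum_comm, hBf]
  conv_rhs => rw [Finset.sum_comm]
  simp only [Finset.mul_sum, LinearMap.comp_apply]
  refine Finset.sum_congr rfl fun V' _ => ?_
  have hdef : ∀ U : Fin k → Fin (m + 2), (μ (opV b (wZ V') * wZ U) : ℝ) =
      (μ (opV b (wZ V' * wZ U)) : ℝ) -
        (if b = ℓ' then (μ (wZ V' * (Zq ℓ' * wZ U - wZ U * Zq ℓ') * 1) : ℝ) else 0) :=
    fun U => CornerEngineMove.opV_mul_right H μ b (wZ V') (wZ U)
  simp_rw [hdef]
  have hc := hcentH μ (wZ V') 1 x ξ hx hξ hξα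
  by_cases hb : b = ℓ'
  · simp only [if_pos hb]
    rw [← sub_eq_zero, ← Finset.sum_sub_distrib]
    refine Eq.trans (b := ∑ U : Fin k → Fin (m + 2), -(η * gd b ξ (η * y₀) * Vt V' y' ξ (η * y₀)) *
        ((μ (wZ V' * (Zq ℓ' * wZ U - wZ U * Zq ℓ') * 1) : ℝ) * Ht U x ξ 0))
      (Finset.sum_congr rfl fun U _ => by ring) ?_
    rw [← Finset.mul_sum, hc, mul_zero]
  · simp only [if_neg hb, sub_zero]

end AbstractEngine

/-- **Hook `cornerEngineMove_y0_blocks`** (registered form of `CornerEngineMove.moveY0_blocks`):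
the blocks of `w ∘ ε` for the permutation moving the outermost transverse variable to the last
slot. [folklore] -/
theorem cornerEngineMove_y0_blocks : ∀ (k l e : ℕ) (h : l + 1 + k + e = l + k + e + 1) (w : Fin (k + l + (e + 1)) → ℝ), let ε : Fin (k + (l + 1) + e) ≃ Fin (k + l + e + 1) := (finSumFinEquiv.symm.trans ((Equiv.sumCongr (finSumFinEquiv.symm.trans ((Equiv.sumComm (Fin k) (Fin (l + 1))).trans finSumFinEquiv)) (Equiv.refl (Fin e))).trans finSumFinEquiv)).trans (((finCongr h).trans (finRotate (l + k + e + 1)).symm).trans (finSumFinEquiv.symm.trans ((Equiv.sumCongr (finSumFinEquiv.symm.trans ((Equiv.sumComm (Fin l) (Fin k)).trans finSumFinEquiv)) (Equiv.refl (Fin (e + 1)))).trans finSumFinEquiv) : Fin (l + k + (e + 1)) ≃ Fin (k + l + (e + 1)))); (fun i : Fin k => w (ε (Fin.castAdd e (Fin.castAdd (l + 1) i)))) = (fun i : Fin k => w (Fin.castAdd (e + 1) (Fin.castAdd l i))) ∧ (fun j : Fin (l + 1) => w (ε (Fin.castAdd e (Fin.natAdd k j)))) = Fin.cons (w (Fin.natAdd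 (k + l) (Fin.last e))) (fun j : Fin l => w (Fin.castAdd (e + 1) (Fin.natAdd k j))) ∧ (fun s : Fin e => w (ε (Fin.natAdd (k + (l + 1)) s))) = (fun s : Fin e => w (Fin.natAdd (k + l) (Fin.castSucc s))) :=
  fun _ _ _ h w => CornerEngineMove.moveY0_blocks h w

end Summit.KontsevichZagierPeriods.FurushoPentagon.PentagonInKZ
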